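import Literature.AlgebraicGeometry.Modules.ZeroSchemeOfSection
import HarnessLib

/-!
# The support of the zero scheme of a section (Fulton B.3.2/B.3.4)

Set-theoretically the zero scheme `Z(t)` of a global section `t` of an `𝒪_X`-module `E`
(`Modules/ZeroSchemeOfSection`: the closed subscheme with ideal sheaf the image of `t^∨ : ℰ^∨ → 𝒪_X`,
Fulton App. B.3.4) is the locus where the local coordinates of `t` vanish (Fulton App. B.3.2: "`Z(s)` is
defined in `U_i` by the ideal generated by `s_{i1}, …, s_{ir}`" — so its points in `U_i` are the common
zeros of the `s_{im}`):

* `range_zeroSchemeι` — the image of `Z(t) ⟶ X` is the support (Mathlib `IdealSheafData.support`) of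
  the ideal sheaf of `Z(t)`;
* `range_zeroSchemeι_inter_eq_zeroLocus` — for `E^∨` affine-localizing and an affine open `V`, the
  image of `Z(t)` meets `V` in the zero locus (Mathlib `Scheme.zeroLocus`) of the ideal of values
  `{μ_V(t|_V)}`;
* `range_zeroSchemeι_inter_eq_zeroLocus_coord`, `mem_range_zeroSchemeι_iff_coord` — inside a finite
  frame `e : 𝒪^I ≅ E|_W`, `V ≤ W` affine: `Z(t) ∩ V = {x ∈ V | λ_i(t|_V)(x) = 0 for all i}`, i.e.
  `x ∈ Z(t) ↔ ∀ i, x ∉ D(λ_i(t|_V))`.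

Theorems only (no definitions, facts, instances, notation).

## References

* W. Fulton, *Intersection Theory*, 2nd ed., Springer 1998, App. B.3.2, B.3.4 (PDF p. 410). [Fulton1998]
* R. Hartshorne, *Algebraic Geometry*, GTM 52 (1977), II Prop. 5.9 (PDF p. 146: the closed subscheme of a
  quasi-coherent ideal sheaf has support `Supp 𝒪_X/𝓘`). [Hartshorne1977]
-/

noncomputable section

open CategoryTheory AlgebraicGeometry Opposite TopologicalSpace

namespace Literature.AlgebraicGeometry.Modules

universe u

variable {X : Scheme.{u}} (E : X.Modules)

/-- The image of `Z(t) ⟶ X` is the support of the ideal sheaf of `Z(t)` (the closed subscheme of a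
quasi-coherent ideal sheaf `𝓘` is supported on `Supp 𝒪_X/𝓘`).
[cite: Hartshorne1977, II Prop. 5.9 (PDF p. 146)] [cite: Fulton1998, B.3.4 (PDF p. 410)] -/
theorem range_zeroSchemeι (t : Γ(E, ⊤)) :
    Set.range (zeroSchemeι E t).base = ((zeroSchemeIdeal E t).support : Set X) :=
  (zeroSchemeIdeal E t).range_subschemeι

/-- The image of `Z(t) ⟶ X` is closed. [cite: Hartshorne1977, II Prop. 5.9 (PDF p. 146)] -/
theorem isClosed_range_zeroSchemeι (t : Γ(E, ⊤)) : IsClosed (Set.range (zeroSchemeι E t).base) := by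
  rw [range_zeroSchemeι]
  exact (zeroSchemeIdeal E t).support.isClosed

variable {E}

/-- **`Z(t)` on an affine open is the zero locus of the values of `t`**: for `E^∨` affine-localizing and
`V` affine, `Z(t) ∩ V = {x ∈ V | μ_V(t|_V)(x) = 0 for all μ ∈ Γ(ℰ^∨, V)}` (the support of `𝒪_X/𝓘`,
`𝓘 =` image of `ℰ^∨ → 𝒪_X`). [cite: Fulton1998, B.3.4 (PDF p. 410)] [cite: Hartshorne1977, II Prop. 5.9 (PDF p. 146)] -/
theorem range_zeroSchemeι_inter_eq_zeroLocus (hE : IsAffineLocalizing (dual E)) (t : Γ(E, ⊤))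
    (V : X.affineOpens) :
    Set.range (zeroSchemeι E t).base ∩ (V : Set X) =
      X.zeroLocus (U := V) (sectionValueIdeal E t V : Set Γ(X, V)) ∩ (V : Set X) := by
  rw [range_zeroSchemeι, Scheme.IdealSheafData.coe_support_inter, zeroSchemeIdeal_ideal hE]

section Frame

variable {W : X.Opens} {I : Type u} (e : SheafOfModules.free I ≅ E.over W) [Fintype I]

/-- **`Z(t)` in a frame is the common zero locus of the coordinates of `t`** (Fulton B.3.2: `Z(s)` is
defined in `U_i` by `s_{i1}, …, s_{ir}`): for `E^∨` affine-localizing, a finite frame `e : 𝒪^I ≅ E|_W`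
and an affine `V ≤ W`, `Z(t) ∩ V = {x ∈ V | λ_i(t|_V)(x) = 0 ∀ i}`. [cite: Fulton1998, B.3.2 (PDF p. 410)] -/
theorem range_zeroSchemeι_inter_eq_zeroLocus_coord (hE : IsAffineLocalizing (dual E)) (t : Γ(E, ⊤))
    (V : X.affineOpens) (k : (V : X.Opens) ⟶ W) :
    Set.range (zeroSchemeι E t).base ∩ (V : Set X) =
      X.zeroLocus (U := V) (Set.range (coord e k (resTop E t V))) ∩ (V : Set X) := by
  rw [range_zeroSchemeι_inter_eq_zeroLocus hE, sectionValueIdeal_eq_span_coord e t k,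
    Scheme.zeroLocus_span]

/-- Pointwise form: a point `x` of an affine `V` inside a finite frame lies in (the image of) `Z(t)` iff
every coordinate `λ_i(t|_V)` vanishes at `x`, i.e. `x ∉ D(λ_i(t|_V))` for all `i`.
[cite: Fulton1998, B.3.2 (PDF p. 410)] -/
theorem mem_range_zeroSchemeι_iff_coord (hE : IsAffineLocalizing (dual E)) (t : Γ(E, ⊤))
    (V : X.affineOpens) (k : (V : X.Opens) ⟶ W) {x : X} (hx : x ∈ (V : X.Opens)) :
    x ∈ Set.range (zeroSchemeι E t).base ↔ ∀ i, x ∉ X.basicOpen (coord e k (resTop E t V) i) := by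
  have h := Set.ext_iff.1 (range_zeroSchemeι_inter_eq_zeroLocus_coord e hE t V k) x
  simp only [Set.mem_inter_iff, SetLike.mem_coe, hx, and_true] at h
  rw [h, Scheme.mem_zeroLocus_iff]
  exact ⟨fun H i => H _ ⟨i, rfl⟩, fun H _ ⟨i, hi⟩ => hi ▸ H i⟩

/-- Off `Z(t)`, some coordinate of `t` is invertible nearby: if `x ∈ V` is not in (the image of) `Z(t)`
then `x ∈ D(λ_i(t|_V))` for some `i`. [cite: Fulton1998, B.3.2 (PDF p. 410)] -/
theorem exists_mem_basicOpen_coord_of_not_mem_range (hE : IsAffineLocalizing (dual E)) (t : Γ(E, ⊤))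
    (V : X.affineOpens) (k : (V : X.Opens) ⟶ W) {x : X} (hx : x ∈ (V : X.Opens))
    (hxZ : x ∉ Set.range (zeroSchemeι E t).base) :
    ∃ i, x ∈ X.basicOpen (coord e k (resTop E t V) i) := by
  by_contra h
  exact hxZ ((mem_range_zeroSchemeι_iff_coord e hE t V k hx).2 fun i hi => h ⟨i, hi⟩)

end Frame

end Literature.AlgebraicGeometry.Modules

end
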